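import Summits.HodgeConjecture.CorCM.IrreducibleOddWeightsProductSpanMinimal
import Summits.HodgeConjecture.CorCM.IrreducibleOddWeightsBlockHelly
import HarnessLib

/-!
# Minimal non-additive families have at most `[Gal(L/ℚ) : A] + 1` members (`A` abelian); under an ABELIAN Galois
# closure the first exceptional mixed class lives on a PAIR `A_i^{a} × A_j^{b}`

COR-CM (cell `pub-hodgecm2`, binder seat `b16` gen 61, count-neutral claim BLOCKS ARE MEMBERS, file H4 — abstract
`G`-slots, CM fields and their realisations; theorems only, no definition, no named fact, no `sorry`).  NEW as stated,
hence under `Summits/`.  HONEST FRAMING: unconditional structure theorems on Hodge classes of products of CM abelian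
varieties; `HC_CM` is neither used nor asserted.

Gen 59 bounded a minimal non-additive family `T₀` (`Hg(∏_{T₀} A_i) ⊊ ∏_{T₀} Hg(A_i)`, all proper sub-families additive)
by the DEGREE form `|T₀| ≤ dim MT(A_i)` for every member, and gen 60 (G10) located the first exceptional mixed class on
such a `T₀`.  Here the INDEX form, from gen 59's index Helly theorem
(`IrreducibleOddWeightsAdditivityHelly`: additivity is decided on sub-families of at most `[G : A] + 1` members when
`A ≤ G` of finite index acts through pairwise commuting permutations) applied to the family `T₀` itself:

* §1 (abstract) `finrank_antiSpan_sigmaType_coe_map_subtype_eq` (a sub-family of a sub-family is a sub-family: transport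
  of `dim U` along `(T' ⊆ T₀) ↦ T'.map val`), **`IrrOdd.card_le_index_succ_of_minimal_nonadditive`** (`|T₀| ≤ [G : A] + 1`),
  `IrrOdd.card_le_two_of_minimal_nonadditive_of_smul_comm` (commuting actions: minimal non-additive families are PAIRS).
* §2 (CM fields, `K_i ↪ L` Galois) **`card_le_index_succ_of_minimal_nonadditive`** (`|T₀| ≤ [Gal(L/ℚ) : A] + 1` for
  `A ≤ Gal(L/ℚ)` with pairwise commuting elements), **`card_le_two_of_minimal_nonadditive_of_comm`** (`Gal(L/ℚ)` abelian
  ⟹ `|T₀| ≤ 2`).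
* §3 (realisations) **`exists_card_le_index_succ_not_hodgeClassesProductSpan`** — if `Hg(∏_i A_i) ⊊ ∏_i Hg(A_i)` the
  first exceptional mixed class lives on a product of copies of at most `[Gal(L/ℚ) : A] + 1` of the factors;
  **`exists_pair_not_hodgeClassesProductSpan_of_comm`** — `Gal(L/ℚ)` ABELIAN (all `K_i` inside one abelian, e.g.
  cyclotomic, field): if `Hg(∏_i A_i) ⊊ ∏_i Hg(A_i)` then some `A_i^{N₁} × A_j^{N₂}` (`i ≠ j`) ALREADY carries a rational
  Hodge class which is not a combination of exterior products — for abelian closures every exceptional mixed phenomenon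
  is visible on two factors, whatever their dimensions and CM types (gen 60 had this only for CM elliptic curves).

## References

* [MoonenZarhin1999LowDim] B. Moonen, Yu. Zarhin, *Hodge classes on abelian varieties of low dimension*, Math. Ann.
  315 (1999), §3 (3.1), Remark (3.9).
* [Serre1977] J.-P. Serre, *Linear Representations of Finite Groups*, GTM 42 (1977), §3.1 Thm. 9 and Cor.
* [Mai1989] L. Mai, *Lower bounds for the ranks of CM types*, J. Number Theory 32 (1989), §2 Prop. 1 (proof).
* [Gordon1999HodgeAVSurvey] B. B. Gordon, *A survey of the Hodge conjecture for abelian varieties*, §3 Theorem (Imai,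
  Murty) with proof; 7.5–7.7.
* [Shimura1998] G. Shimura, *Abelian Varieties with Complex Multiplication and Modular Functions* (1998), §8.1.
-/

set_option autoImplicit false

noncomputable section

open scoped BigOperators

open CategoryTheory CategoryTheory.Limits NumberField

namespace Summit.HodgeConjecture.CorCM

namespace IrrOdd

open Literature.NumberTheory.ComplexMultiplication

universe w u v

variable {G : Type w} [Group G] {I : Type u} {E : I → Type v} [∀ i, MulAction G (E i)] [Fintype I]
  [∀ i, Fintype (E i)]

/-! ### §1 Abstract slots: minimal non-additive families have at most `[G : A] + 1` members -/

omit [Fintype I] [∀ i, Fintype (E i)] in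
/-- **A sub-family of a sub-family is a sub-family**: for `T' ⊆ T₀` (as a finset of the subtype) the family indexed by
`T'` inside the family indexed by `T₀` has the `dim U` of the family indexed by `T'.map val ⊆ I` (transport along the
equivariant bijection of slots). [cite: Deligne1982HodgeCycles, I Ex. 3.7] -/
theorem finrank_antiSpan_sigmaType_coe_map_subtype_eq (Φ : ∀ i, Set (E i)) (T₀ : Finset I)
    (T' : Finset (T₀ : Set I)) :
    Module.finrank ℚ (antiSpan G (sigmaType fun j : (T' : Set (T₀ : Set I)) => Φ (j : (T₀ : Set I)))) =
      Module.finrank ℚ (antiSpan G (sigmaType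
        fun j : ((T'.map (Function.Embedding.subtype _) : Finset I) : Set I) => Φ j)) := by
  classical
  set q : (Σ j : (T' : Set (T₀ : Set I)), E (j : (T₀ : Set I))) →
      Σ j : ((T'.map (Function.Embedding.subtype _) : Finset I) : Set I), E j :=
    fun x => ⟨⟨(x.1 : (T₀ : Set I)), Finset.mem_coe.2 (Finset.mem_map.2 ⟨x.1.1, x.1.2, rfl⟩)⟩, x.2⟩ with hq
  have hq_smul : ∀ (g : G) (x : Σ j : (T' : Set (T₀ : Set I)), E (j : (T₀ : Set I))), q (g • x) = g • q x := by
    rintro g ⟨⟨⟨i, hi₀⟩, hi'⟩, s⟩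
    rfl
  have hq_surj : Function.Surjective q := by
    rintro ⟨⟨i, hi⟩, s⟩
    obtain ⟨a, ha, rfl⟩ := Finset.mem_map.1 (Finset.mem_coe.1 hi)
    exact ⟨⟨⟨a, ha⟩, s⟩, rfl⟩
  have hq_pre : q ⁻¹' (sigmaType fun j : ((T'.map (Function.Embedding.subtype _) : Finset I) : Set I) => Φ j) =
      sigmaType fun j : (T' : Set (T₀ : Set I)) => Φ (j : (T₀ : Set I)) := by
    ext x
    obtain ⟨⟨⟨i, hi₀⟩, hi'⟩, s⟩ := x
    rfl
  rw [← hq_pre]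
  exact finrank_antiSpan_preimage_eq_of_surjective (G := G) _ q hq_smul hq_surj

omit [Fintype I] in
/-- **MINIMAL NON-ADDITIVE FAMILIES HAVE AT MOST `[G : A] + 1` MEMBERS** (`A ≤ G` of finite index acting through pairwise
commuting permutations; ANY subsets `Φ_i`, no representation listed): if `T₀` is non-additive while all its proper
sub-families are additive, then `|T₀| ≤ [G : A] + 1` — the Helly number bounds every minimal obstruction.
[cite: Serre1977, §3.1 Cor. to Thm. 9] [cite: Mai1989, §2 Prop. 1 (proof)] [cite: MoonenZarhin1999LowDim, §3 (3.1)] -/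
theorem card_le_index_succ_of_minimal_nonadditive (Φ : ∀ i, Set (E i)) (A : Subgroup G) [A.FiniteIndex]
    (hA : ∀ a ∈ A, ∀ b ∈ A, ∀ (i : I) (s : E i), a • b • s = b • a • s) (T₀ : Finset I)
    (hnot : Module.finrank ℚ (antiSpan G (sigmaType fun j : (T₀ : Set I) => Φ j)) ≠
      ∑ j : (T₀ : Set I), Module.finrank ℚ (antiSpan G (Φ j)))
    (hmin : ∀ T : Finset I, T ⊂ T₀ →
      Module.finrank ℚ (antiSpan G (sigmaType fun j : (T : Set I) => Φ j)) =
        ∑ j : (T : Set I), Module.finrank ℚ (antiSpan G (Φ j))) :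
    T₀.card ≤ A.index + 1 := by
  classical
  by_contra hlt
  push Not at hlt
  apply hnot
  -- the index Helly theorem for the family indexed by `T₀`
  refine (finrank_antiSpan_sigmaType_eq_sum_iff_forall_card_le_index_succ_of_smul_comm (G := G)
    (E := fun j : (T₀ : Set I) => E j) (fun j => Φ j) A fun a ha b hb j s => hA a ha b hb j s).2 fun T' hT' => ?_
  -- `T'.map val` is a proper sub-family of `T₀`
  have hsub : (T'.map (Function.Embedding.subtype _) : Finset I) ⊂ T₀ := by
    refine Finset.ssubset_iff_subset_ne.2 ⟨fun i hi => ?_, fun h => ?_⟩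
    · obtain ⟨a, -, rfl⟩ := Finset.mem_map.1 hi
      exact a.2
    · have hcard : (T'.map (Function.Embedding.subtype _) : Finset I).card = T'.card := Finset.card_map _
      rw [h] at hcard
      omega
  have h := hmin _ hsub
  rw [finrank_antiSpan_sigmaType_coe_map_subtype_eq Φ T₀ T']
  rw [h]
  -- the sums agree
  have h1 : ∑ j : ((T'.map (Function.Embedding.subtype _) : Finset I) : Set I), Module.finrank ℚ (antiSpan G (Φ j)) =
      ∑ j ∈ (T'.map (Function.Embedding.subtype _) : Finset I), Module.finrank ℚ (antiSpan G (Φ j)) :=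
    Finset.sum_coe_sort _ fun j => Module.finrank ℚ (antiSpan G (Φ j))
  have h2 : ∑ j : (T' : Set (T₀ : Set I)), Module.finrank ℚ (antiSpan G (Φ (j : (T₀ : Set I)))) =
      ∑ j ∈ T', Module.finrank ℚ (antiSpan G (Φ (j : I))) :=
    Finset.sum_coe_sort T' fun j => Module.finrank ℚ (antiSpan G (Φ (j : I)))
  rw [h1, h2, Finset.sum_map]
  rfl

omit [Fintype I] in
/-- **Commuting permutations: minimal non-additive families are PAIRS** (`[G : G] + 1 = 2`).
[cite: Serre1977, §3.1 Thm. 9] [cite: MoonenZarhin1999LowDim, §3 (3.1) and Remark (3.9)] -/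
theorem card_le_two_of_minimal_nonadditive_of_smul_comm (Φ : ∀ i, Set (E i))
    (hG : ∀ (a b : G) (i : I) (s : E i), a • b • s = b • a • s) (T₀ : Finset I)
    (hnot : Module.finrank ℚ (antiSpan G (sigmaType fun j : (T₀ : Set I) => Φ j)) ≠
      ∑ j : (T₀ : Set I), Module.finrank ℚ (antiSpan G (Φ j)))
    (hmin : ∀ T : Finset I, T ⊂ T₀ →
      Module.finrank ℚ (antiSpan G (sigmaType fun j : (T : Set I) => Φ j)) =
        ∑ j : (T : Set I), Module.finrank ℚ (antiSpan G (Φ j))) :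
    T₀.card ≤ 2 := by
  have h := card_le_index_succ_of_minimal_nonadditive Φ (⊤ : Subgroup G) (fun a _ b _ i s => hG a b i s) T₀ hnot hmin
  rwa [Subgroup.index_top] at h

end IrrOdd

/-! ### §2 CM fields: `|T₀| ≤ [Gal(L/ℚ) : A] + 1` -/

open Literature.NumberTheory.ComplexMultiplication
open Literature.AlgebraicGeometry.Motives (AbelianVariety CMType)
open Literature.AlgebraicGeometry.Motives.AbelianVariety
open Literature.AlgebraicGeometry.HodgeTheory
open Literature.AlgebraicGeometry.ComplexMultiplication (IsCMTypeRealisation)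
open Literature.AlgebraicGeometry.Pohlmann1968

variable {I : Type} [Fintype I] [DecidableEq I] {K : I → Type} [∀ i, Field (K i)] [∀ i, NumberField (K i)]
  [∀ i, IsCMField (K i)] {L : Type} [Field L] [NumberField L] [Normal ℚ L]

omit [Fintype I] [DecidableEq I] in
/-- **MINIMAL NON-ADDITIVE FAMILIES OF CM TYPES HAVE AT MOST `[Gal(L/ℚ) : A] + 1` MEMBERS.**  CM fields `K_i ↪ L` (`L`
Galois over `ℚ`), `A ≤ Gal(L/ℚ)` with pairwise commuting elements, ARBITRARY CM types: if `Hg(∏_{T₀} A_i) ⊊ ∏_{T₀} Hg(A_i)`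
while every non-empty proper sub-family of `T₀` is additive, then `|T₀| ≤ [Gal(L/ℚ) : A] + 1`.
[cite: Serre1977, §3.1 Cor. to Thm. 9] [cite: MoonenZarhin1999LowDim, §3 (3.1)] [cite: Shimura1998, §8.1] -/
theorem card_le_index_succ_of_minimal_nonadditive (ι : L →+* ℂ) (e : ∀ i, K i →+* L) (Φ : ∀ i, CMType (K i))
    (A : Subgroup (L ≃ₐ[ℚ] L)) (hA : ∀ a ∈ A, ∀ b ∈ A, a * b = b * a) (T₀ : Finset I)
    (hnot : CMAlgebra.cmFamilyRank (K := fun j : (T₀ : Set I) => K j) (fun j => Φ j) + T₀.card ≠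
      (∑ j ∈ T₀, cmTypeRank (Φ j)) + 1)
    (hmin : ∀ T : Finset I, T ⊂ T₀ → T.Nonempty →
      CMAlgebra.cmFamilyRank (K := fun j : (T : Set I) => K j) (fun j => Φ j) + T.card =
        (∑ j ∈ T, cmTypeRank (Φ j)) + 1) :
    T₀.card ≤ A.index + 1 := by
  classical
  obtain ⟨r, hr, hsurj⟩ := exists_restrictHom ι
  haveI : ∀ i, Nonempty (K i →+* ℂ) := fun i => inferInstance
  have hindex : (A.comap r).index = A.index := A.index_comap_of_surjective hsurj
  haveI : (A.comap r).FiniteIndex := ⟨by rw [hindex]; exact Subgroup.FiniteIndex.index_ne_zero⟩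
  by_cases hT₀ : T₀.Nonempty
  · rw [← hindex]
    refine IrrOdd.card_le_index_succ_of_minimal_nonadditive (G := ℂ ≃+* ℂ) (E := fun i => K i →+* ℂ)
      (fun i => (Φ i).1) (A.comap r) (smul_comm_of_comap_restrictHom ι e hr A hA) T₀
      (fun h => hnot ((cmFamilyRank_add_card_eq_iff_finrank_eq Φ T₀ hT₀).2 h)) fun T hT => ?_
    by_cases hTne : T.Nonempty
    · exact (cmFamilyRank_add_card_eq_iff_finrank_eq Φ T hTne).1 (hmin T hT hTne)
    · rw [Finset.not_nonempty_iff_eq_empty.1 hTne]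
      exact IrrOdd.finrank_antiSpan_sigmaType_coe_empty_eq_sum (G := ℂ ≃+* ℂ) fun i => (Φ i).1
  · rw [Finset.not_nonempty_iff_eq_empty.1 hT₀, Finset.card_empty]
    exact Nat.zero_le _

omit [Fintype I] [DecidableEq I] in
/-- **`Gal(L/ℚ)` ABELIAN: MINIMAL NON-ADDITIVE FAMILIES ARE PAIRS** — every failure of `Hg(∏ A_i) = ∏ Hg(A_i)` among CM
abelian varieties with CM by subfields of one abelian number field comes from two of them.
[cite: Gordon1999HodgeAVSurvey, §3 Theorem and 7.5–7.7] [cite: MoonenZarhin1999LowDim, §3 (3.1) and Remark (3.9)] -/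
theorem card_le_two_of_minimal_nonadditive_of_comm (ι : L →+* ℂ) (e : ∀ i, K i →+* L) (Φ : ∀ i, CMType (K i))
    (hG : ∀ a b : L ≃ₐ[ℚ] L, a * b = b * a) (T₀ : Finset I)
    (hnot : CMAlgebra.cmFamilyRank (K := fun j : (T₀ : Set I) => K j) (fun j => Φ j) + T₀.card ≠
      (∑ j ∈ T₀, cmTypeRank (Φ j)) + 1)
    (hmin : ∀ T : Finset I, T ⊂ T₀ → T.Nonempty →
      CMAlgebra.cmFamilyRank (K := fun j : (T : Set I) => K j) (fun j => Φ j) + T.card =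
        (∑ j ∈ T, cmTypeRank (Φ j)) + 1) :
    T₀.card ≤ 2 := by
  have h := card_le_index_succ_of_minimal_nonadditive ι e Φ ⊤ (fun a _ b _ => hG a b) T₀ hnot hmin
  rwa [Subgroup.index_top] at h

/-! ### §3 Realisations: where the first exceptional mixed class lives, index form -/

variable {Φ : ∀ i, CMType (K i)} {A : I → AbelianVariety ℂ} {ιA : ∀ i, 𝓞 (K i) →+* End (A i)}
  {θ : ∀ i, K i →+* Module.End ℂ (complexBetti (A i).X 1)}

/-- **THE FIRST EXCEPTIONAL MIXED CLASS LIVES ON AT MOST `[Gal(L/ℚ) : A'] + 1` OF THE FACTORS.**  Realisations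
`A_i ⊨ (K_i; Φ_i)` with `K_i ↪ L` Galois, `A' ≤ Gal(L/ℚ)` with pairwise commuting elements, and
`Hg(∏_i A_i) ⊊ ∏_i Hg(A_i)`.  Then there are `T₀ ⊆ I` with `|T₀| ≤ [Gal(L/ℚ) : A'] + 1`, `i ∈ T₀` and `π₂` with values in
`T₀ ∖ {i}` such that `A_i^{N₁} × ∏_k A_{π₂ k}` carries a rational Hodge class NOT in the span of exterior products of
Hodge classes of the two factors. [cite: MoonenZarhin1999LowDim, §3 (3.1)] [cite: Serre1977, §3.1 Cor. to Thm. 9]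
[cite: Gordon1999HodgeAVSurvey, 7.5–7.7] -/
theorem exists_card_le_index_succ_not_hodgeClassesProductSpan [Nonempty I] (ι : L →+* ℂ) (e : ∀ i, K i →+* L)
    (A' : Subgroup (L ≃ₐ[ℚ] L)) (hA' : ∀ a ∈ A', ∀ b ∈ A', a * b = b * a)
    (hA : ∀ i, IsCMTypeRealisation (Φ i) (A i) (ιA i) (θ i))
    (hne : CMAlgebra.cmFamilyRank Φ + Fintype.card I ≠ (∑ i, cmTypeRank (Φ i)) + 1) :
    ∃ (T₀ : Finset I) (i : I), i ∈ T₀ ∧ T₀.card ≤ A'.index + 1 ∧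
      ∃ (N₁ N₂ : ℕ) (_ : NeZero N₁) (_ : NeZero N₂) (π₂ : Fin N₂ → I),
        (∀ k, π₂ k ∈ T₀.erase i) ∧ ¬ HodgeClassesProductSpan (⨁ fun _ : Fin N₁ => A i) (⨁ fun k => A (π₂ k)) := by
  obtain ⟨T₀, i, hi, hnot, hmin, -, N₁, N₂, hN₁, hN₂, π₂, hπ₂, hfail⟩ :=
    exists_minimal_not_hodgeClassesProductSpan_of_cmFamilyRank_add_card_ne hA hne
  exact ⟨T₀, i, hi, card_le_index_succ_of_minimal_nonadditive ι e Φ A' hA' T₀ hnot hmin, N₁, N₂, hN₁, hN₂, π₂, hπ₂,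
    hfail⟩

/-- **`Gal(L/ℚ)` ABELIAN: THE FIRST EXCEPTIONAL MIXED CLASS LIVES ON A PAIR `A_i^{N₁} × A_j^{N₂}`.**  Realisations
`A_i ⊨ (K_i; Φ_i)` of ARBITRARY CM types of subfields `K_i` of an abelian Galois number field `L` (e.g. all `K_i`
cyclotomic), with `Hg(∏_i A_i) ⊊ ∏_i Hg(A_i)`.  Then for some `i ≠ j` and `N₁, N₂ ≥ 1` the product `A_i^{N₁} × A_j^{N₂}`
carries a rational Hodge class which is NOT a `ℂ`-combination of exterior products of Hodge classes of `A_i^{N₁}` and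
`A_j^{N₂}`: under an abelian closure every exceptional mixed phenomenon is visible on TWO factors.
[cite: Gordon1999HodgeAVSurvey, §3 Theorem (Imai, Murty) and 7.5–7.7] [cite: MoonenZarhin1999LowDim, §3 (3.1) and Remark (3.9)] -/
theorem exists_pair_not_hodgeClassesProductSpan_of_comm [Nonempty I] (ι : L →+* ℂ) (e : ∀ i, K i →+* L)
    (hG : ∀ a b : L ≃ₐ[ℚ] L, a * b = b * a) (hA : ∀ i, IsCMTypeRealisation (Φ i) (A i) (ιA i) (θ i))
    (hne : CMAlgebra.cmFamilyRank Φ + Fintype.card I ≠ (∑ i, cmTypeRank (Φ i)) + 1) :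
    ∃ (i j : I), j ≠ i ∧ ∃ (N₁ N₂ : ℕ) (_ : NeZero N₁) (_ : NeZero N₂),
      ¬ HodgeClassesProductSpan (⨁ fun _ : Fin N₁ => A i) (⨁ fun _ : Fin N₂ => A j) := by
  obtain ⟨T₀, i, hi, hcard, N₁, N₂, hN₁, hN₂, π₂, hπ₂, hnot⟩ :=
    exists_card_le_index_succ_not_hodgeClassesProductSpan ι e ⊤ (fun a _ b _ => hG a b) hA hne
  rw [Subgroup.index_top] at hcard
  -- `T₀ ∖ {i}` has exactly one element `j`, so `π₂` is constant
  haveI := hN₂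
  have hj : (T₀.erase i).card ≤ 1 := by rw [Finset.card_erase_of_mem hi]; omega
  obtain ⟨j, hjmem⟩ : ∃ j, π₂ 0 = j := ⟨_, rfl⟩
  have hconst : ∀ k, π₂ k = j := fun k => by
    have := Finset.card_le_one.1 hj (π₂ k) (hπ₂ k) (π₂ 0) (hπ₂ 0)
    rw [this, hjmem]
  have hfun : (fun k => A (π₂ k)) = fun _ : Fin N₂ => A j := funext fun k => by rw [hconst k]
  refine ⟨i, j, ?_, N₁, N₂, hN₁, hN₂, ?_⟩
  · have := hπ₂ 0
    rw [hjmem] at this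
    exact (Finset.mem_erase.1 this).1
  · rw [← hfun]
    exact hnot

end Summit.HodgeConjecture.CorCM

end
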